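import Mathlib.RingTheory.AdicCompletion.Completeness
import Mathlib.RingTheory.AdicCompletion.LocalRing
import Mathlib.RingTheory.MvPolynomial.Homogeneous
import Mathlib.RingTheory.Polynomial.Basic
import Mathlib.RingTheory.GradedAlgebra.Basic
import Mathlib.RingTheory.MvPowerSeries.Equiv
import Mathlib.RingTheory.Finiteness.Ideal
import Mathlib.RingTheory.Ideal.Quotient.Noetherian
import HarnessLib

/-!
# Adically complete rings with Noetherian special fibre are Noetherian (Stacks 05GH, 0316)

Topic: `Literature/AlgebraicGeometry/Resolution` (brick "N" of the decomposition of Matsumura's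
Thm. 32.3 recorded in `FormalFibres.lean`: every leaf about formal fibres — Stacks 07NY, 07PN,
07PP, 07PR — first needs the completion `(A_𝔭)^` to be Noetherian). Mathlib (this tree) has
`AdicCompletion I R` with its ring structure, `IsAdicComplete`, flatness over a Noetherian
ring and `IsNoetherianRing R⟦X⟧`, but not the Noetherianity of `AdicCompletion I R`. This
file PROVES it, via the classical lemma on complete filtered rings (everything here is a
theorem; no new definitions, no named facts).

## Content (namespace `Literature.AlgGeom`)

* `isNoetherianRing_of_isAdicComplete` — **Stacks 05GH (core)**: `I ⊆ B` finitely generated,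
  `B` `I`-adically complete, `B/I` Noetherian ⟹ `B` Noetherian. Proof as in Stacks: initial
  forms of an ideal `J` live in the Noetherian ring `(B/I)[X₁, …, X_t]` (the ideal they span
  is finitely generated), which yields `g₁, …, g_m ∈ J` with
  `J ∩ Iⁿ ⊆ Σ I^{n-d_j} g_j + J ∩ I^{n+1}`; successive approximation and completeness give
  `J = (g₁, …, g_m)`. (`isNoetherianRing_of_isAdicComplete_span` is the version with named
  generators `f : Fin t → B` of `I`, which carries the proof.)
* `Stacks05GH` — the printed statement for `AdicCompletion I R`: `R/I` Noetherian and `I`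
  finitely generated ⟹ `R^∧` Noetherian and `IR^∧`-adically complete.
* `Stacks0316` — `R` Noetherian ⟹ `AdicCompletion I R` Noetherian (Matsumura Thm. 8.12);
  `isNoetherianRing_adicCompletion_maximalIdeal` — the local case `(A, 𝔪)^`.
* `isNoetherianRing_mvPowerSeries` — **Stacks 0306** / Matsumura Thm. 3.3: `R[[x₁, …, xₙ]]` is
  Noetherian for `R` Noetherian (as the `(X)`-adic completion of `R[x₁, …, xₙ]`, Mathlib's
  `MvPowerSeries.toAdicCompletionAlgEquiv`).
* Lemmas: `homogeneousComponent_mul_of_isHomogeneous` (degree-`n` part of `H·G` for `G`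
  homogeneous), `eval_mem_pow_succ_of_coeff_mem`, `mem_pow_smul_top_iff`.

## Sources

* The Stacks Project (`algebra.tex`, Section "Completion"): Tag 05GH ("Let `I` be an ideal of
  a ring `R`. Assume (1) `R/I` is a Noetherian ring, (2) `I` is finitely generated. Then the
  completion `R^∧` of `R` with respect to `I` is a Noetherian ring complete with respect to
  `IR^∧`."), Tag 0316 ("Let `R` be a Noetherian ring. Let `I` be an ideal of `R`. The completion
  `R^∧` of `R` with respect to `I` is Noetherian."), Tag 0306 ("If `R` is a Noetherian ring,
  then so is the formal power series ring `R[[x₁, …, xₙ]]`."). [StacksProject]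
* H. Matsumura, *Commutative Ring Theory*, CUP 1986: Thm. 3.3 [PDF 26] ("If `A` is Noetherian
  then so are `A[X]` and `A[[X]]`"), Thm. 8.12 [PDF 74] ("… Hence `Â` is a Noetherian ring").
  [Matsumura1987]
-/

noncomputable section

namespace Literature.AlgebraicGeometry.Resolution

universe u v

open MvPolynomial

/-! ## Two lemmas on homogeneous polynomials -/

section Homogeneous

variable {σ : Type v} {R : Type u} [CommRing R]

/-- The degree-`n` component of `H * G` for `G` homogeneous of degree `d` is `H_{n-d} * G`
(and `0` if `d > n`). [folklore] -/
theorem homogeneousComponent_mul_of_isHomogeneous (H G : MvPolynomial σ R) {d : ℕ} (n : ℕ)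
    (hG : G.IsHomogeneous d) :
    homogeneousComponent n (H * G) =
      if d ≤ n then homogeneousComponent (n - d) H * G else 0 := by
  letI := MvPolynomial.gradedAlgebra (σ := σ) (R := R)
  have h := DirectSum.coe_decompose_mul_of_right_mem (𝒜 := homogeneousSubmodule σ R)
    (a := H) n hG
  have e1 : ((DirectSum.decompose (homogeneousSubmodule σ R) (H * G)) n : MvPolynomial σ R) =
      homogeneousComponent n (H * G) :=
    MvPolynomial.decomposition.decompose'_apply (H * G) n
  have e2 : ((DirectSum.decompose (homogeneousSubmodule σ R) H) (n - d) : MvPolynomial σ R) =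
      homogeneousComponent (n - d) H :=
    MvPolynomial.decomposition.decompose'_apply H (n - d)
  rw [e1, e2] at h
  exact h

/-- If `F` is homogeneous of degree `n` in `t` variables and all its coefficients lie in the
ideal `I = (f₁, …, f_t)`, then `F(f) ∈ I^{n+1}`. [folklore] -/
theorem eval_mem_pow_succ_of_coeff_mem {t : ℕ} (f : Fin t → R) {F : MvPolynomial (Fin t) R}
    {n : ℕ} (hF : F.IsHomogeneous n) (hc : ∀ m, F.coeff m ∈ Ideal.span (Set.range f)) :
    MvPolynomial.eval f F ∈ Ideal.span (Set.range f) ^ (n + 1) := by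
  rw [F.as_sum, map_sum]
  refine Ideal.sum_mem _ fun m hm => ?_
  rw [MvPolynomial.eval_monomial, pow_succ']
  refine Ideal.mul_mem_mul (hc m) ?_
  have hdeg : m.degree = n := by
    by_contra h
    exact (MvPolynomial.mem_support_iff.mp hm) (hF.coeff_eq_zero h)
  refine (Ideal.mem_span_pow_iff_exists_isHomogeneous f _).mpr
    ⟨MvPolynomial.monomial m 1, MvPolynomial.isHomogeneous_monomial 1 hdeg, ?_⟩
  simp [MvPolynomial.eval_monomial]

end Homogeneous

/-! ## The main theorem -/

section Main

variable {B : Type u} [CommRing B]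

/-- Membership in `I^k • ⊤ ⊆ B` is membership in `I^k`. [folklore] -/
theorem mem_pow_smul_top_iff (I : Ideal B) (k : ℕ) (x : B) :
    x ∈ (I ^ k • ⊤ : Submodule B B) ↔ x ∈ I ^ k := by
  change x ∈ I ^ k * ⊤ ↔ _
  rw [Ideal.mul_top]

/-- **Stacks 05GH** (core), generators form: if `B` is complete for the `(f₁, …, f_t)`-adic
topology and `B/(f₁, …, f_t)` is Noetherian then `B` is Noetherian.
[cite: StacksProject, Tag 05GH] -/
theorem isNoetherianRing_of_isAdicComplete_span {t : ℕ} (f : Fin t → B)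
    [IsAdicComplete (Ideal.span (Set.range f)) B]
    [IsNoetherianRing (B ⧸ Ideal.span (Set.range f))] : IsNoetherianRing B := by
  set I : Ideal B := Ideal.span (Set.range f) with hIdef
  set π : B →+* B ⧸ I := Ideal.Quotient.mk I with hπ
  refine (isNoetherianRing_iff_ideal_fg B).mpr fun J => ?_
  -- the ideal of initial forms of `J`, inside the Noetherian ring `(B ⧸ I)[X₁, …, X_t]`
  let S : Set (MvPolynomial (Fin t) (B ⧸ I)) :=
    {q | ∃ (n : ℕ) (G : MvPolynomial (Fin t) B), G.IsHomogeneous n ∧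
      MvPolynomial.map π G = q ∧ MvPolynomial.eval f G ∈ J ⊔ I ^ (n + 1)}
  have hfg : (Ideal.span S).FG := IsNoetherian.noetherian _
  obtain ⟨T, hTS, hTspan⟩ := (Submodule.fg_span_iff_fg_span_finset_subset S).mp hfg
  -- data attached to the finitely many initial forms
  have hdata : ∀ q : T, ∃ (n : ℕ) (G : MvPolynomial (Fin t) B), G.IsHomogeneous n ∧
      MvPolynomial.map π G = q ∧ ∃ g : B, g ∈ J ∧ ∃ e : B, e ∈ I ^ (n + 1) ∧
        MvPolynomial.eval f G = g + e := by
    rintro ⟨q, hq⟩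
    obtain ⟨n, G, hG, hmap, hev⟩ := hTS hq
    obtain ⟨g, hg, e, he, hge⟩ := Submodule.mem_sup.mp hev
    exact ⟨n, G, hG, hmap, g, hg, e, he, hge.symm⟩
  choose d G hGhom hGmap g hgJ e heI hGeval using hdata
  -- one approximation step: `J ∩ Iⁿ ⊆ Σ I^{n-d_q} g_q + J ∩ I^{n+1}`
  have approx : ∀ (n : ℕ) (x : B), x ∈ J → x ∈ I ^ n →
      ∃ a : T → B, (∀ q, a q ∈ I ^ (n - d q)) ∧ (∀ q, a q * e q ∈ I ^ (n + 1)) ∧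
        x - ∑ q, a q * g q ∈ I ^ (n + 1) := by
    intro n x hxJ hxI
    obtain ⟨G₀, hG₀hom, hG₀eval⟩ := (Ideal.mem_span_pow_iff_exists_isHomogeneous f x).mp hxI
    have hTspan' : Ideal.span (↑T : Set (MvPolynomial (Fin t) (B ⧸ I))) = Ideal.span S :=
      hTspan.symm
    have hmem : MvPolynomial.map π G₀ ∈ Ideal.span (↑T : Set (MvPolynomial (Fin t) (B ⧸ I))) := by
      rw [hTspan']
      refine Ideal.subset_span ⟨n, G₀, hG₀hom, rfl, ?_⟩
      rw [hG₀eval]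
      exact Ideal.mem_sup_left hxJ
    obtain ⟨c, hc⟩ := Submodule.mem_span_finset'.mp hmem
    have hlift : ∀ q : T, ∃ C : MvPolynomial (Fin t) B, MvPolynomial.map π C = c q := fun q =>
      MvPolynomial.map_surjective π Ideal.Quotient.mk_surjective (c q)
    choose C hC using hlift
    set E : MvPolynomial (Fin t) B := G₀ - ∑ q, C q * G q with hE
    have hE0 : MvPolynomial.map π E = 0 := by
      simp only [hE, map_sub, map_sum, map_mul, hC, hGmap]
      rw [← hc]
      simp [smul_eq_mul]
    have hEcoeff : ∀ m, E.coeff m ∈ I := by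
      intro m
      have h := congrArg (MvPolynomial.coeff m) hE0
      rw [MvPolynomial.coeff_map, MvPolynomial.coeff_zero] at h
      exact Ideal.Quotient.eq_zero_iff_mem.mp h
    set En := homogeneousComponent n E with hEn
    have hEn_coeff : ∀ m, En.coeff m ∈ I := by
      intro m
      rw [hEn, coeff_homogeneousComponent]
      split_ifs
      · exact hEcoeff m
      · exact I.zero_mem
    have hEn_eval : MvPolynomial.eval f En ∈ I ^ (n + 1) :=
      eval_mem_pow_succ_of_coeff_mem f (homogeneousComponent_isHomogeneous n E) hEn_coeff
    have hEn_eq : En = G₀ - ∑ q, (if d q ≤ n then homogeneousComponent (n - d q) (C q) * G q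
        else 0) := by
      rw [hEn, hE, map_sub, map_sum, homogeneousComponent_eq_self hG₀hom]
      congr 1
      exact Finset.sum_congr rfl fun q _ =>
        homogeneousComponent_mul_of_isHomogeneous (C q) (G q) n (hGhom q)
    -- the coefficients `a_q`
    let a : T → B := fun q =>
      if d q ≤ n then MvPolynomial.eval f (homogeneousComponent (n - d q) (C q)) else 0
    have ha1 : ∀ q, a q ∈ I ^ (n - d q) := by
      intro q
      simp only [a]
      split_ifs with h
      · exact (Ideal.mem_span_pow_iff_exists_isHomogeneous f _).mpr
          ⟨_, homogeneousComponent_isHomogeneous _ _, rfl⟩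
      · exact Ideal.zero_mem _
    have ha2 : ∀ q, a q * e q ∈ I ^ (n + 1) := by
      intro q
      by_cases h : d q ≤ n
      · have hmul := Ideal.mul_mem_mul (ha1 q) (heI q)
        rwa [← pow_add, show n - d q + (d q + 1) = n + 1 by omega] at hmul
      · simp [a, h]
    refine ⟨a, ha1, ha2, ?_⟩
    have hsum : ∑ q, MvPolynomial.eval f
        (if d q ≤ n then homogeneousComponent (n - d q) (C q) * G q else 0) =
        ∑ q, (a q * g q + a q * e q) := by
      refine Finset.sum_congr rfl fun q _ => ?_
      simp only [a]
      split_ifs with h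
      · rw [map_mul, hGeval q, mul_add]
      · simp
    have key : x - ∑ q, a q * g q = MvPolynomial.eval f En + ∑ q, a q * e q := by
      rw [hEn_eq, map_sub, map_sum, hG₀eval, hsum, Finset.sum_add_distrib]
      ring
    rw [key]
    exact add_mem hEn_eval (Ideal.sum_mem _ fun q _ => ha2 q)
  -- iterate the approximation, starting from `x ∈ J = J ∩ I⁰`
  suffices hJ : J = Ideal.span (Set.range g) by
    rw [hJ]
    exact Submodule.fg_span (Set.finite_range g)
  refine le_antisymm (fun x hx => ?_) (Ideal.span_le.mpr ?_)
  swap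
  · rintro _ ⟨q, rfl⟩
    exact hgJ q
  choose! a ha1 ha2 ha3 using approx
  let xs : ℕ → B := fun n => Nat.rec x (fun k y => y - ∑ q, a k y q * g q) n
  have hxs0 : xs 0 = x := rfl
  have hxs_succ : ∀ k, xs (k + 1) = xs k - ∑ q, a k (xs k) q * g q := fun k => rfl
  have hxs : ∀ k, xs k ∈ J ∧ xs k ∈ I ^ k := by
    intro k
    induction k with
    | zero => exact ⟨hx, by simp [hxs0]⟩
    | succ k ih =>
        refine ⟨?_, ?_⟩
        · rw [hxs_succ]
          exact sub_mem ih.1 (Ideal.sum_mem _ fun q _ => Ideal.mul_mem_left _ _ (hgJ q))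
        · rw [hxs_succ]
          exact ha3 k (xs k) ih.1 ih.2
  -- partial sums of the coefficient series and the telescoping identity
  let ps : ℕ → T → B := fun N q => ∑ k ∈ Finset.range N, a k (xs k) q
  have htel : ∀ N, x - ∑ q, ps N q * g q = xs N := by
    intro N
    induction N with
    | zero => simp [ps, hxs0]
    | succ N ih =>
        have hps : ∀ q, ps (N + 1) q = ps N q + a N (xs N) q := fun q =>
          Finset.sum_range_succ _ _
        calc x - ∑ q, ps (N + 1) q * g q
            = (x - ∑ q, ps N q * g q) - ∑ q, a N (xs N) q * g q := by
              simp only [hps, add_mul, Finset.sum_add_distrib]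
              ring
          _ = xs (N + 1) := by rw [ih, hxs_succ]
  -- a uniform bound on the degrees
  let D : ℕ := Finset.univ.sup d
  have hdD : ∀ q, d q ≤ D := fun q => Finset.le_sup (Finset.mem_univ q)
  have ha_unif : ∀ k q, a k (xs k) q ∈ I ^ (k - D) := fun k q =>
    Ideal.pow_le_pow_right (by have := hdD q; omega) (ha1 k (xs k) (hxs k).1 (hxs k).2 q)
  -- the coefficient series are Cauchy
  have hcauchy : ∀ q, ∀ {k l : ℕ}, k ≤ l →
      ps (k + D) q ≡ ps (l + D) q [SMOD (I ^ k • ⊤ : Submodule B B)] := by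
    intro q k l hkl
    rw [SModEq.sub_mem, mem_pow_smul_top_iff]
    have hsplit : ps (l + D) q = ps (k + D) q + ∑ i ∈ Finset.Ico (k + D) (l + D), a i (xs i) q := by
      simp only [ps]
      rw [Finset.range_eq_Ico, Finset.range_eq_Ico]
      exact (Finset.sum_Ico_consecutive _ (Nat.zero_le _) (by omega)).symm
    rw [hsplit, sub_add_cancel_left]
    refine neg_mem (Ideal.sum_mem _ fun i hi => ?_)
    have hik : k ≤ i - D := by
      have := (Finset.mem_Ico.mp hi).1
      omega
    exact Ideal.pow_le_pow_right hik (ha_unif i q)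
  have hlim : ∀ q, ∃ L : B, ∀ k, ps (k + D) q ≡ L [SMOD (I ^ k • ⊤ : Submodule B B)] :=
    fun q => IsPrecomplete.prec' _ (hcauchy q)
  choose L hL using hlim
  -- `x - Σ L_q g_q` is divisible by every power of `I`, hence zero
  have hzero : x - ∑ q, L q * g q = 0 := by
    refine IsHausdorff.haus' (I := I) _ fun k => ?_
    rw [SModEq.zero, mem_pow_smul_top_iff]
    have hrw : x - ∑ q, L q * g q = xs (k + D) + ∑ q, (ps (k + D) q - L q) * g q := by
      rw [← htel (k + D)]
      simp only [sub_mul, Finset.sum_sub_distrib]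
      ring
    rw [hrw]
    refine add_mem (Ideal.pow_le_pow_right (Nat.le_add_right k D) (hxs (k + D)).2)
      (Ideal.sum_mem _ fun q _ => Ideal.mul_mem_right _ _ ?_)
    have h := hL q k
    rw [SModEq.sub_mem, mem_pow_smul_top_iff] at h
    exact h
  rw [sub_eq_zero.mp hzero]
  exact Ideal.sum_mem _ fun q _ => Ideal.mul_mem_left _ _ (Ideal.subset_span ⟨q, rfl⟩)

/-- **Stacks 05GH** (core): if `I ⊆ B` is a finitely generated ideal, `B` is `I`-adically
complete and `B/I` is Noetherian, then `B` is Noetherian. [cite: StacksProject, Tag 05GH] -/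
theorem isNoetherianRing_of_isAdicComplete (I : Ideal B) (hI : I.FG) [IsAdicComplete I B]
    [IsNoetherianRing (B ⧸ I)] : IsNoetherianRing B := by
  obtain ⟨t, f, hf⟩ := Submodule.fg_iff_exists_fin_generating_family.mp hI
  subst hf
  exact isNoetherianRing_of_isAdicComplete_span f

end Main

/-! ## Completions of Noetherian rings -/

section Completion

variable (R : Type u) [CommRing R]

/-- **Stacks 05GH**: "Let `I` be an ideal of a ring `R`. Assume (1) `R/I` is a Noetherian ring,
(2) `I` is finitely generated. Then the completion `R^∧` of `R` with respect to `I` is a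
Noetherian ring complete with respect to `IR^∧`." [cite: StacksProject, Tag 05GH] -/
theorem Stacks05GH (I : Ideal R) (hI : I.FG) [IsNoetherianRing (R ⧸ I)] :
    IsNoetherianRing (AdicCompletion I R) ∧
      IsAdicComplete (I.map (algebraMap R (AdicCompletion I R))) (AdicCompletion I R) := by
  have hc := AdicCompletion.isAdicComplete_self I hI
  refine ⟨?_, hc⟩
  haveI := hc
  haveI : IsNoetherianRing
      (AdicCompletion I R ⧸ I.map (algebraMap R (AdicCompletion I R))) := by
    rw [← AdicCompletion.ker_evalOneₐ_eq_map I hI]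
    exact isNoetherianRing_of_ringEquiv (R ⧸ I)
      (RingHom.quotientKerEquivOfSurjective (f := (AdicCompletion.evalOneₐ I).toRingHom)
        (AdicCompletion.evalOneₐ_surjective I)).symm
  exact isNoetherianRing_of_isAdicComplete (I.map (algebraMap R (AdicCompletion I R))) (hI.map _)

/-- **Stacks 0316** (Matsumura, Thm. 8.12, last sentence): "Let `R` be a Noetherian ring. Let `I`
be an ideal of `R`. The completion `R^∧` of `R` with respect to `I` is Noetherian."
[cite: StacksProject, Tag 0316] -/
theorem Stacks0316 [IsNoetherianRing R] (I : Ideal R) : IsNoetherianRing (AdicCompletion I R) :=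
  (Stacks05GH R I (IsNoetherian.noetherian I)).1

/-- In particular the completion `(A, 𝔪)^` of a Noetherian local ring is a Noetherian (complete
local) ring — the case used for formal fibres. [cite: StacksProject, Tag 0316] -/
theorem isNoetherianRing_adicCompletion_maximalIdeal (A : Type u) [CommRing A] [IsLocalRing A]
    [IsNoetherianRing A] :
    IsNoetherianRing (AdicCompletion (IsLocalRing.maximalIdeal A) A) :=
  Stacks0316 A _

/-- **Stacks 0306** (Matsumura, Thm. 3.3 for power series): formal power series in finitely many
variables over a Noetherian ring form a Noetherian ring — here as the `(X)`-adic completion of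
the polynomial ring (Mathlib's `MvPowerSeries.toAdicCompletionAlgEquiv`).
[cite: StacksProject, Tag 0306] -/
theorem isNoetherianRing_mvPowerSeries (σ : Type v) [Finite σ] [IsNoetherianRing R] :
    IsNoetherianRing (MvPowerSeries σ R) :=
  haveI := Stacks0316 (MvPolynomial σ R) (MvPolynomial.idealOfVars σ R)
  isNoetherianRing_of_ringEquiv _ (MvPowerSeries.toAdicCompletionAlgEquiv σ R).symm.toRingEquiv

end Completion

end Literature.AlgebraicGeometry.Resolution

end
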